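import Literature.Probability.RandomPlanarGeometry.HexSAWStripBridgeRenewal
import HarnessLib

/-!
# The horizontal bridges of exact span at the strip threshold: `Σ_{span(h) = σ} x_c^{|h|} y_T^{#top(h)} ≤ K_T` uniformly in `σ`
# (the span-pointwise law — renewal structure of Duminil-Copin–Hammond bridges, Seneta's sub-invariant vectors)

Topic `Literature/Probability/RandomPlanarGeometry` (continues `HexSAWStripBridgeDecomposition.lean` / `HexSAWStripBridgeRenewal.lean` — the horizontal bridges `HV.hBridgesN`,
their renewal split `HV.fstP` / `HV.sndP` (`HV.split_injOn`, `HV.wD_eq_mul_fstP_sndP`), the level classes `HV.HBk` / `HV.HBab`, the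
irreducible matrices `HV.Imat` and their monotone limit `HV.Iinf` with `HV.exists_partialSum_pow_Iinf_le` below `y_T`, irreducibility
`HV.reach_Imat_all`, and the tree lemma `Literature.Analysis.Matrix.nonnegMat_exists_subInvariant_vector`).  Sources: H. Duminil-Copin,
A. Hammond, *Self-avoiding walk is sub-ballistic*, CMP 324 (2013) §2.2 (bridges "`ω₁(0) < ω₁(i) ≤ ω₁(n)`", renewal points, irreducible
bridges and their free concatenation — here in the horizontal direction of the strip `S_T`); E. Seneta, *Non-negative matrices* (1973)
§6.1–§6.2 (R-theory: sub-invariant vectors, Theorem 6.3); N. R. Beaton et al., CMP 326 (2014), arXiv:1109.0358v5, §3.2 Corollary 8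
(p. 12: the threshold `y_T`, "radius of convergence y_T").  None of them states the present bound; it is the lane's.

## What is proved (namespace `Literature.Probability.RandomPlanarGeometry.SAW.HV`; `x_c = hexCriticalFugacity`, `T ≥ 1`)

* `hsp l` — the horizontal span `ξ(last) − ξ(head)`; `hsp_xstd`, `one_le_hsp_of_isHBridge` (a bridge with ≥ 2 vertices has span ≥ 1),
  `hsp_split` (additive at the first renewal index).
* Span slices `SUset`/`SMset` (all / irreducible standard bridges `a → b` of span `σ`), their sums `SUs`/`SMs` and `2T × 2T` matrices
  `SUM`/`SMM`; `sum_SMM_le_Imat` (`Σ_σ M_σ ≤ I_N`), `SUM_eq_zero_of_le` (no bridge of span ≤ 0).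
* ★ `SUM_le_split` — the span-sliced split inequality `U_σ(a,b) ≤ M_σ(a,b) + Σ_{τ ∈ [1,σ)} (M_τ U_{σ−τ})(a,b)` (first-renewal split,
  injective, weights multiply; every irreducible piece has span ≥ 1 — no zero-span pieces, unlike the contact slicing of
  `HexSAWStripThresholdPointwise`).
* ★★ `SUM_mulVec_le_of_subInvariant` — for `y ∈ [1, y_T)` and a sub-invariant vector `s` of `I(y)`: `U_σ(y) s ≤ s` for EVERY `σ`
  (strong induction on the span); ★★ `exists_SUM_le` — `U_σ(a,b)(y) ≤ K` uniformly in `y ∈ [1,y_T)`, `N`, `σ`, `a`, `b` (ratio bound from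
  the irreducibility witnesses at `y = 1`); ★★★ `exists_SUs_stripYT_le` — the same AT `y_T` (continuity of the finite sums).
* ★★★ `exists_hBridgesN_span_stripYT_le` — **SPAN-POINTWISE LAW**: `∃ K, ∀ N σ, Σ_{h ∈ hBridgesN T N, |h| ≥ 2, hsp h = σ} x_c^{|h|} y_T^{#top(h)} ≤ K`.

Why it matters (lane «pcv-sawmu», a-p2 g17): it is the renewal-theorem-type BOUNDEDNESS of the horizontal two-point structure AT the
threshold (the tree/HOME had only the partial sums `Σ_{k<n} I(y)^k ≤ C/(y_T − y)` below `y_T` and the contact-pointwise law); it is the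
input for the boundedness of the side classes `E_{T,L}(x_c; y_T)` and the lock-step of `A_{T,L}` and `B_{T,L}` at `y_T` (next cars).
NOT claimed: convergence of the span slices (a renewal THEOREM), positivity of their limit, anything uniform in `T`.
-/

noncomputable section

open Finset Filter Topology Matrix Literature.Probability.LatticeModels Literature.Probability.Percolation Literature.Analysis.Matrix

namespace Literature.Probability.RandomPlanarGeometry.SAW.HV

/-! ### §1 The horizontal span of a bridge and the span-sliced classes -/

/-- The horizontal span of a vertex list: `ξ(last) − ξ(head)` (junk for `[]`). [cite: DuminilCopinHammond2013, §2.2 (the span of a bridge); lane] -/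
def hsp (l : List HV) : ℤ := xi (l.getLast?.getD hvOrigin) - xi (l.head?.getD hvOrigin)

section SpanSliced

variable {T : ℕ}

/-- Standard horizontal bridges `a → b` (at most `N + 1` vertices) of span exactly `σ` (plumbing). [folklore] -/
def SUset (T N : ℕ) (σ : ℤ) (a b : ℤ) : Finset (List HV) := (HBab T N a b).filter fun l => hsp l = σ

/-- Irreducible standard horizontal bridges `a → b` of span exactly `σ` (plumbing). [folklore] -/
def SMset (T N : ℕ) (σ : ℤ) (a b : ℤ) : Finset (List HV) := (HBk T N 1 a b).filter fun l => hsp l = σ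

/-- `U_σ(a,b)(y) = Σ x_c^{|h|−1} y^{#top(h.tail)}` over the bridges of span `σ` (plumbing). [folklore] -/
def SUs (T N : ℕ) (σ : ℤ) (a b : ℤ) (y : ℝ) : ℝ := ∑ l ∈ SUset T N σ a b, wD T y l

/-- `M_σ(a,b)(y)` over the irreducible bridges of span `σ` (plumbing). [folklore] -/
def SMs (T N : ℕ) (σ : ℤ) (a b : ℤ) (y : ℝ) : ℝ := ∑ l ∈ SMset T N σ a b, wD T y l

/-- The span-sliced matrices on the `2T` levels (plumbing). [folklore] -/
def SUM (T N : ℕ) (σ : ℤ) (y : ℝ) : Matrix (Fin (2 * T)) (Fin (2 * T)) ℝ := fun a b => SUs T N σ (a : ℕ) (b : ℕ) y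

/-- The span-sliced irreducible matrices (plumbing). [folklore] -/
def SMM (T N : ℕ) (σ : ℤ) (y : ℝ) : Matrix (Fin (2 * T)) (Fin (2 * T)) ℝ := fun a b => SMs T N σ (a : ℕ) (b : ℕ) y

variable {N : ℕ} {y : ℝ} {σ : ℤ}

/-- Non-negativity of the sliced sums. [cite: DuminilCopinHammond2013, §2.2; lane plumbing] -/
theorem SUs_SMs_nonneg (hy : 0 ≤ y) (a b : ℤ) : 0 ≤ SUs T N σ a b y ∧ 0 ≤ SMs T N σ a b y :=
  ⟨sum_nonneg fun l _ => wD_nonneg T hy l, sum_nonneg fun l _ => wD_nonneg T hy l⟩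

/-- `xstd` keeps the span. [cite: DuminilCopinHammond2013, §2.2; lane plumbing] -/
theorem hsp_xstd (l : List HV) : hsp (xstd l) = hsp l := by
  rcases eq_or_ne l [] with rfl | hne
  · rfl
  · rw [hsp, hsp, xstd, List.getLast?_map, List.head?_map, List.getLast?_eq_some_getLast hne, List.head?_eq_some_head hne]
    simp only [Option.map_some, Option.getD_some, xi_shift_zero]
    ring

/-- The span of a horizontal bridge with at least two vertices is at least one. [cite: DuminilCopinHammond2013, §2.2 ("ω₁(0) < ω₁(i) ≤ ω₁(n)")] -/
theorem one_le_hsp_of_isHBridge {l : List HV} (hB : IsHBridge l) (h2 : 2 ≤ l.length) : 1 ≤ hsp l := by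
  obtain ⟨hne, hall⟩ := hB
  have hlast : l.getLast hne ∈ l.tail := by
    obtain ⟨a, t, rfl⟩ := List.exists_cons_of_ne_nil hne
    have ht : t ≠ [] := by rintro rfl; simp at h2
    rw [List.tail_cons, List.getLast_cons ht]
    exact List.getLast_mem ht
  have h := (hall _ hlast).1
  rw [hsp, List.getLast?_eq_some_getLast hne, List.head?_eq_some_head hne, Option.getD_some, Option.getD_some]
  omega

/-- The span splits additively at the first renewal index. [cite: DuminilCopinHammond2013, §2.2 (decomposition at renewal points)] -/
theorem hsp_split {l : List HV} (h : (renIdxs l).Nonempty) : hsp l = hsp (fstP l) + hsp (sndP l) := by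
  obtain ⟨e1, e2, e3, e4⟩ := fstP_sndP_ends h
  obtain ⟨hne1, hne2⟩ := fstP_sndP_ne_nil h
  have hl : l ≠ [] := by rintro rfl; simp [renIdxs] at h
  rw [hsp, hsp, hsp, List.getLast?_eq_some_getLast hl, List.head?_eq_some_head hl, List.getLast?_eq_some_getLast hne1,
    List.head?_eq_some_head hne1, List.getLast?_eq_some_getLast hne2, List.head?_eq_some_head hne2]
  simp only [Option.getD_some, e1 hne1, e2 hne1, e3 hne2, e4 hne2]
  ring

/-- The slices `M_σ`, `σ ∈ s`, are disjoint parts of `I_N`: `Σ_{σ ∈ s} M_σ(y) ≤ I_N(y)` entrywise (`y ≥ 0`).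
[cite: DuminilCopinHammond2013, §2.2] -/
theorem sum_SMM_le_Imat (hy : 0 ≤ y) (s : Finset ℤ) (a b : Fin (2 * T)) :
    (∑ σ ∈ s, SMM T N σ y) a b ≤ Imat T N y a b := by
  classical
  rw [Matrix.sum_apply]
  simp only [SMM, SMs, Imat, Dk]
  have hdisj : Set.PairwiseDisjoint (s : Set ℤ) fun σ => SMset T N σ (a : ℕ) (b : ℕ) := by
    intro i _ i' _ hne
    rw [Function.onFun, disjoint_left]
    intro l h1 h2
    rw [SMset, mem_filter] at h1 h2
    exact hne (h1.2.symm.trans h2.2)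
  rw [← sum_biUnion hdisj]
  refine sum_le_sum_of_subset_of_nonneg (fun l hl => ?_) fun _ _ _ => wD_nonneg T hy _
  rw [mem_biUnion] at hl
  obtain ⟨i, -, hi⟩ := hl
  exact (mem_filter.1 hi).1

end SpanSliced

section Split

variable {T N : ℕ} {y : ℝ} {σ : ℤ}

/-- No bridge has span `≤ 0`: `U_σ = 0` for `σ ≤ 0`. [cite: DuminilCopinHammond2013, §2.2; lane plumbing] -/
theorem SUM_eq_zero_of_le (hσ : σ ≤ 0) (y : ℝ) (a b : Fin (2 * T)) : SUM T N σ y a b = 0 := by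
  rw [SUM, SUs]
  refine sum_eq_zero fun l hl => ?_
  exfalso
  rw [SUset, mem_filter, HBab, mem_filter, mem_hBridgesN_iff] at hl
  obtain ⟨⟨⟨-, -, -, -, -, hB⟩, h2, -, -⟩, hspan⟩ := hl
  have := one_le_hsp_of_isHBridge hB h2
  omega

set_option maxHeartbeats 400000 in
/-- ★ **The span-sliced split inequality**: a bridge of span `σ` is irreducible, or an irreducible bridge of span `τ ∈ [1, σ)` followed
by a bridge of span `σ − τ` (injectively, weights multiply):
`U_σ(a,b) ≤ M_σ(a,b) + Σ_{τ ∈ [1,σ)} Σ_c M_τ(a,c) U_{σ−τ}(c,b)`. [cite: DuminilCopinHammond2013, §2.2 (decomposition at the first renewal point)] -/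
theorem SUM_le_split (hy : 0 ≤ y) (σ : ℤ) (a b : Fin (2 * T)) :
    SUM T N σ y a b ≤ SMM T N σ y a b + (∑ τ ∈ Finset.Ico (1 : ℤ) σ, SMM T N τ y * SUM T N (σ - τ) y) a b := by
  classical
  set S := SUset T N σ (a : ℕ) (b : ℕ) with hS
  set Sirr := S.filter fun l => renIdxs l = ∅ with hSirr
  set Sred := S.filter fun l => renIdxs l ≠ ∅ with hSred
  have hmemS : ∀ l ∈ S, l.IsChain hvGraph.Adj ∧ l.Nodup ∧ l.length ≤ N + 1 ∧ (∃ v, l.head? = some v ∧ v.1 = 0) ∧ InLev T l ∧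
      IsHBridge l ∧ 2 ≤ l.length ∧ hdLev l = a ∧ ltLev l = b ∧ hsp l = σ := by
    intro l hl
    rw [hS, SUset, mem_filter, HBab, mem_filter, mem_hBridgesN_iff] at hl
    obtain ⟨⟨⟨hc, hnd, hlen, hh, hin, hB⟩, h2, ha, hb⟩, hsz⟩ := hl
    exact ⟨hc, hnd, hlen, hh, hin, hB, h2, ha, hb, hsz⟩
  -- (1) the irreducible part
  have hirr : ∑ l ∈ Sirr, wD T y l ≤ SMM T N σ y a b := by
    rw [SMM, SMs]
    refine sum_le_sum_of_subset_of_nonneg (fun l hl => ?_) fun _ _ _ => wD_nonneg T hy _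
    rw [hSirr, mem_filter] at hl
    obtain ⟨hl, hren⟩ := hl
    obtain ⟨hc, hnd, hlen, hh, hin, hB, h2, ha, hb, hsz⟩ := hmemS l hl
    rw [SMset, mem_filter, HBk, mem_filter]
    exact ⟨⟨mem_hBridgesN_iff.2 ⟨hc, hnd, hlen, hh, hin, hB⟩, h2, by rw [npieces, hren]; rfl, ha, hb⟩, hsz⟩
  -- (2) the reducible part: the split map into the double union
  set tgt : Finset (List HV × List HV) := (Finset.univ : Finset (Fin (2 * T))).biUnion fun c =>
    (Finset.Ico (1 : ℤ) σ).biUnion fun τ => SMset T N τ (a : ℕ) (c : ℕ) ×ˢ SUset T N (σ - τ) (c : ℕ) (b : ℕ) with htgt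
  have himg : ∀ l ∈ Sred, (fstP l, xstd (sndP l)) ∈ tgt := by
    intro l hl
    rw [hSred, mem_filter] at hl
    obtain ⟨hl, hren'⟩ := hl
    have hren : (renIdxs l).Nonempty := Finset.nonempty_iff_ne_empty.2 hren'
    obtain ⟨hc, hnd, hlen, ⟨v, hv, hv0⟩, hin, hB, h2, ha, hb, hsz⟩ := hmemS l hl
    have hlens := length_fstP_sndP hren
    obtain ⟨hB1, hB2⟩ := isHBridge_fstP_sndP hB hren
    obtain ⟨e1, e2, e3, e4⟩ := fstP_sndP_ends hren
    obtain ⟨hne1, hne2⟩ := fstP_sndP_ne_nil hren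
    have hl0 : l ≠ [] := by rintro rfl; simp at h2
    have hspl := hsp_split hren
    have hf := (fIdx_spec hren).1
    have hlen1 : 2 ≤ (fstP l).length := by rw [fstP, List.length_take]; have := hf.1; have := hf.2.1; omega
    have hlen2 : 2 ≤ (sndP l).length := by rw [sndP, List.length_drop]; have := hf.2.1; omega
    have hτ1 : 1 ≤ hsp (fstP l) := one_le_hsp_of_isHBridge hB1 hlen1
    have hτ2 : 1 ≤ hsp (sndP l) := one_le_hsp_of_isHBridge hB2 hlen2
    set cz : ℤ := lev (l[fIdx l]'(by have := (fIdx_spec hren).1.2.1; omega)) with hcz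
    have hcz0 : 0 ≤ cz ∧ cz ≤ 2 * (T : ℤ) - 1 := hin _ (List.getElem_mem _)
    let c : Fin (2 * T) := ⟨cz.toNat, by omega⟩
    have hcc : ((c : ℕ) : ℤ) = cz := by simp [c]; omega
    rw [htgt, mem_biUnion]
    refine ⟨c, mem_univ _, ?_⟩
    rw [mem_biUnion]
    refine ⟨hsp (fstP l), Finset.mem_Ico.2 ⟨hτ1, by omega⟩, mem_product.2 ⟨?_, ?_⟩⟩
    · show fstP l ∈ SMset T N _ _ _
      rw [SMset, mem_filter, HBk, mem_filter, mem_hBridgesN_iff]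
      refine ⟨⟨⟨hc.take _, hnd.sublist (List.take_sublist _ _), by omega, ⟨v, ?_, hv0⟩,
        fun w hw => hin w ((List.take_sublist _ _).subset hw), hB1⟩, hlen1, by rw [npieces, renIdxs_fstP hren]; rfl, ?_, ?_⟩, rfl⟩
      · rw [fstP, List.head?_take, if_neg (by omega), hv]
      · rw [hdLev, fstP, List.head?_take, if_neg (by omega)]; rw [hdLev] at ha; exact ha
      · rw [ltLev, List.getLast?_eq_some_getLast hne1, Option.getD_some, e2, hcc]
    · show xstd (sndP l) ∈ SUset T N _ _ _
      rw [SUset, mem_filter, HBab, mem_filter, mem_hBridgesN_iff]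
      have hv2 : (sndP l).head? = some (l[fIdx l]'(by have := (fIdx_spec hren).1.2.1; omega)) := by
        rw [List.head?_eq_some_head hne2, e3]
      refine ⟨⟨⟨isChain_xstd (hc.drop _), nodup_xstd (hnd.sublist (List.drop_sublist _ _)), by rw [length_xstd]; omega,
        ⟨_, head?_xstd hv2, rfl⟩, inLev_xstd fun w hw => hin w ((List.drop_sublist _ _).subset hw), isHBridge_xstd hB2⟩,
        by rw [length_xstd]; exact hlen2, ?_, ?_⟩, by rw [hsp_xstd]; omega⟩
      · rw [hdLev, head?_xstd hv2, Option.getD_some, hcc, hcz]; simp [lev, bit]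
      · rw [ltLev, xstd, List.getLast?_map, List.getLast?_eq_some_getLast hne2, Option.map_some, Option.getD_some, lev_shift_zero, e4]
        rw [ltLev, List.getLast?_eq_some_getLast hl0, Option.getD_some] at hb; exact hb
  have hinj : Set.InjOn (fun l : List HV => (fstP l, xstd (sndP l))) (Sred : Set (List HV)) := by
    intro l hl l' hl' h
    rw [mem_coe, hSred, mem_filter] at hl hl'
    exact split_injOn (Finset.nonempty_iff_ne_empty.2 hl.2) (Finset.nonempty_iff_ne_empty.2 hl'.2) h
  have hred : ∑ l ∈ Sred, wD T y l ≤ (∑ τ ∈ Finset.Ico (1 : ℤ) σ, SMM T N τ y * SUM T N (σ - τ) y) a b := by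
    calc ∑ l ∈ Sred, wD T y l = ∑ l ∈ Sred, wD T y (fstP l) * wD T y (xstd (sndP l)) := by
          refine sum_congr rfl fun l hl => ?_
          rw [hSred, mem_filter] at hl
          rw [wD_eq_mul_fstP_sndP T y (Finset.nonempty_iff_ne_empty.2 hl.2)]
          congr 1
          rw [wD, wD, length_xstd, xstd, ← List.map_tail, topCnt_map_shift]
      _ = ∑ pq ∈ Sred.image fun l => (fstP l, xstd (sndP l)), wD T y pq.1 * wD T y pq.2 := by rw [sum_image hinj]
      _ ≤ ∑ pq ∈ tgt, wD T y pq.1 * wD T y pq.2 := by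
          refine sum_le_sum_of_subset_of_nonneg (fun pq hpq => ?_) fun pq _ _ => mul_nonneg (wD_nonneg T hy _) (wD_nonneg T hy _)
          rw [mem_image] at hpq
          obtain ⟨l, hl, rfl⟩ := hpq
          exact himg l hl
      _ = (∑ τ ∈ Finset.Ico (1 : ℤ) σ, SMM T N τ y * SUM T N (σ - τ) y) a b := by
          rw [Matrix.sum_apply, htgt, sum_biUnion]
          · have inner : ∀ c : Fin (2 * T), ∑ pq ∈ (Finset.Ico (1 : ℤ) σ).biUnion (fun τ =>
                SMset T N τ (a : ℕ) (c : ℕ) ×ˢ SUset T N (σ - τ) (c : ℕ) (b : ℕ)), wD T y pq.1 * wD T y pq.2 =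
                ∑ τ ∈ Finset.Ico (1 : ℤ) σ, SMs T N τ (a : ℕ) (c : ℕ) y * SUs T N (σ - τ) (c : ℕ) (b : ℕ) y := by
              intro c
              rw [sum_biUnion]
              · refine sum_congr rfl fun τ _ => ?_
                rw [sum_product, SMs, SUs, sum_mul_sum]
              · intro i _ i' _ hne
                rw [Function.onFun, disjoint_left]
                intro pq h1 h2
                rw [mem_product, SMset, mem_filter] at h1 h2
                exact hne (h1.1.2.symm.trans h2.1.2)
            simp_rw [inner]
            rw [sum_comm]
            refine sum_congr rfl fun τ _ => ?_
            rw [Matrix.mul_apply]; rfl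
          · intro c _ c' _ hcc'
            rw [Function.onFun, disjoint_left]
            intro pq h1 h2
            rw [mem_biUnion] at h1 h2
            obtain ⟨i, -, h1⟩ := h1
            obtain ⟨i', -, h2⟩ := h2
            rw [mem_product, SMset, mem_filter, HBk, mem_filter] at h1 h2
            have e1 := h1.1.1.2.2.2.2; have e2 := h2.1.1.2.2.2.2
            exact hcc' (Fin.ext (by have := e1.symm.trans e2; exact_mod_cast this))
  have hsplitS : ∑ l ∈ S, wD T y l = ∑ l ∈ Sirr, wD T y l + ∑ l ∈ Sred, wD T y l := by
    rw [hSirr, hSred, ← sum_filter_add_sum_filter_not S (fun l => renIdxs l = ∅)]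
  calc SUM T N σ y a b = ∑ l ∈ S, wD T y l := rfl
    _ ≤ _ := by rw [hsplitS]; exact add_le_add hirr hred

end Split

/-! ### §3 The sub-invariant vector and the uniform bound below the threshold -/

section Analytic

variable {T N : ℕ} {y : ℝ}

/-- Iterating `A s ≤ s` for `A ≥ 0`: `A^k s ≤ s`. [cite: Seneta1973, §6.2 (sub-invariant vectors)] (Edition 4: `private` — statement-twin of `HV.pow_mulVec_le_of_mulVec_le` in `HexSAWStripThresholdPointwise.lean`, which this file does not import.) -/
private theorem pow_mulVec_le_of_subInvariant {ι : Type*} [Fintype ι] [DecidableEq ι] {A : Matrix ι ι ℝ} (hA : ∀ a b, 0 ≤ A a b)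
    {s : ι → ℝ} (hs : A *ᵥ s ≤ s) (k : ℕ) : (A ^ k) *ᵥ s ≤ s := by
  induction k with
  | zero => simp
  | succ k ih =>
    rw [pow_succ', ← Matrix.mulVec_mulVec]
    exact (nonnegMat_mulVec_le_mulVec_of_le hA ih).trans hs

/-- `Σ_{σ ∈ s} M_σ(y) ≤ I(y)` entrywise for `y ∈ [1, y_T)`. [cite: DuminilCopinHammond2013, §2.2] -/
theorem sum_SMM_le_Iinf (hT : 1 ≤ T) (hy : y ∈ Set.Ico 1 (stripYT T)) (s : Finset ℤ) (a b : Fin (2 * T)) :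
    (∑ σ ∈ s, SMM T N σ y) a b ≤ Iinf T y a b :=
  (sum_SMM_le_Imat (sub_threshold_of_mem_Ico hT hy).2.1 s a b).trans (Imat_le_Iinf hT hy N a b)

/-- `M_σ ≥ 0`, `U_σ ≥ 0` entrywise (`y ≥ 0`). [cite: DuminilCopinHammond2013, §2.2; lane plumbing] -/
theorem SMM_SUM_nonneg (hy : 0 ≤ y) (σ : ℤ) (a b : Fin (2 * T)) : 0 ≤ SMM T N σ y a b ∧ 0 ≤ SUM T N σ y a b :=
  ⟨(SUs_SMs_nonneg (T := T) (N := N) (σ := σ) hy _ _).2, (SUs_SMs_nonneg (T := T) (N := N) (σ := σ) hy _ _).1⟩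

/-- Powers of `I(y)` are summable entrywise below the threshold. [cite: BeatonBousquetMelouDeGierDuminilCopinGuttmann2014, Corollary 8; Seneta1973, §6.1] (Edition 4: `private` — statement-twin of `HV.summable_pow_Iinf` in `HexSAWStripThresholdPointwise.lean`, which this file does not import.) -/
private theorem summable_pow_Iinf' (hT : 1 ≤ T) (hy : y ∈ Set.Ico 1 (stripYT T)) (a b : Fin (2 * T)) :
    Summable fun k => (Iinf T y ^ k) a b := by
  obtain ⟨B, hB⟩ := exists_partialSum_pow_Iinf_le hT hy
  refine summable_of_sum_range_le (fun k => nonnegMat_pow_apply_nonneg (Iinf_nonneg hT hy) k a b) (c := B) fun n => ?_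
  rw [← Matrix.sum_apply]; exact hB n a b

/-- ★★ **The span slices are sub-invariant**: for a sub-invariant vector `s` of `I(y)` (`I(y) s ≤ s`, `y ∈ [1, y_T)`),
`U_σ(y) s ≤ s` for every span `σ` — by strong induction on `σ`: `U_σ s ≤ M_σ s + Σ_{τ<σ} M_τ U_{σ−τ} s ≤ (Σ_{τ ≤ σ} M_τ) s ≤ I s ≤ s`.
[cite: Seneta1973, §6.2 Theorem 6.3 (sub-invariant vectors); DuminilCopinHammond2013, §2.2; lane] -/
theorem SUM_mulVec_le_of_subInvariant (hT : 1 ≤ T) (hy : y ∈ Set.Ico 1 (stripYT T)) {s : Fin (2 * T) → ℝ} (hs0 : 0 ≤ s)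
    (hAs : Iinf T y *ᵥ s ≤ s) (σ : ℤ) : SUM T N σ y *ᵥ s ≤ s := by
  classical
  have hy0 : 0 ≤ y := (sub_threshold_of_mem_Ico hT hy).2.1
  -- strong induction over the integer span via `n : ℕ` with `σ ≤ n`
  suffices key : ∀ n : ℕ, ∀ σ : ℤ, σ ≤ n → SUM T N σ y *ᵥ s ≤ s from key σ.toNat σ (Int.self_le_toNat σ)
  intro n
  induction n with
  | zero =>
    intro σ hσ
    have h0 : SUM T N σ y = 0 := by ext a b; exact SUM_eq_zero_of_le (by omega) y a b
    rw [h0, Matrix.zero_mulVec]; exact hs0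
  | succ n ih =>
    intro σ hσ
    rcases lt_or_eq_of_le hσ with hlt | heq
    · exact ih σ (by omega)
    · -- σ = n + 1 ≥ 1
      have hsplit : SUM T N σ y *ᵥ s ≤ SMM T N σ y *ᵥ s + ∑ τ ∈ Finset.Ico (1 : ℤ) σ, SMM T N τ y *ᵥ (SUM T N (σ - τ) y *ᵥ s) := by
        have h1 : SUM T N σ y *ᵥ s ≤ (SMM T N σ y + ∑ τ ∈ Finset.Ico (1 : ℤ) σ, SMM T N τ y * SUM T N (σ - τ) y) *ᵥ s :=
          nonnegMat_mulVec_le_mulVec_of_entry_le (fun a b => SUM_le_split hy0 σ a b) hs0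
        refine h1.trans (le_of_eq ?_)
        rw [Matrix.add_mulVec, Matrix.sum_mulVec]
        congr 1
        exact sum_congr rfl fun i _ => (Matrix.mulVec_mulVec _ _ _).symm
      have hterm : ∀ τ ∈ Finset.Ico (1 : ℤ) σ, SMM T N τ y *ᵥ (SUM T N (σ - τ) y *ᵥ s) ≤ SMM T N τ y *ᵥ s := fun τ hτ =>
        nonnegMat_mulVec_le_mulVec_of_le (fun a b => (SMM_SUM_nonneg hy0 τ a b).1) (ih (σ - τ) (by rw [Finset.mem_Ico] at hτ; omega))
      have hsum : ∑ τ ∈ Finset.Ico (1 : ℤ) σ, SMM T N τ y *ᵥ (SUM T N (σ - τ) y *ᵥ s) ≤ (∑ τ ∈ Finset.Ico (1 : ℤ) σ, SMM T N τ y) *ᵥ s := by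
        rw [Matrix.sum_mulVec]; exact sum_le_sum hterm
      have hall : SMM T N σ y *ᵥ s + (∑ τ ∈ Finset.Ico (1 : ℤ) σ, SMM T N τ y) *ᵥ s = (∑ τ ∈ Finset.Icc (1 : ℤ) σ, SMM T N τ y) *ᵥ s := by
        rw [← Matrix.add_mulVec]
        congr 1
        have hσ1 : (1 : ℤ) ≤ σ := by omega
        rw [← Finset.Ico_insert_right hσ1, sum_insert Finset.right_notMem_Ico, add_comm]
      have hIs : (∑ τ ∈ Finset.Icc (1 : ℤ) σ, SMM T N τ y) *ᵥ s ≤ s :=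
        (nonnegMat_mulVec_le_mulVec_of_entry_le (fun a b => sum_SMM_le_Iinf hT hy _ a b) hs0).trans hAs
      calc SUM T N σ y *ᵥ s ≤ SMM T N σ y *ᵥ s + ∑ τ ∈ Finset.Ico (1 : ℤ) σ, SMM T N τ y *ᵥ (SUM T N (σ - τ) y *ᵥ s) := hsplit
        _ ≤ SMM T N σ y *ᵥ s + (∑ τ ∈ Finset.Ico (1 : ℤ) σ, SMM T N τ y) *ᵥ s := add_le_add le_rfl hsum
        _ = (∑ τ ∈ Finset.Icc (1 : ℤ) σ, SMM T N τ y) *ᵥ s := hall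
        _ ≤ s := hIs

/-- ★★ **The uniform bound on the span slices below the threshold**: there is `K = K(T)` with `U_σ(a,b)(y) ≤ K` for all
`y ∈ [1, y_T)`, `N`, `σ`, `a`, `b` (sub-invariant vector of `I(y)` from the tree's `nonnegMat_exists_subInvariant_vector`, and the ratio bound
`s_b ≤ K_r s_a` from the irreducibility witnesses at `y = 1`).
[cite: Seneta1973, §6.1 Theorem 6.1 and §6.2 Theorem 6.3; DuminilCopinHammond2013, §2.2; lane] -/
theorem exists_SUM_le (hT : 1 ≤ T) :
    ∃ K : ℝ, ∀ y ∈ Set.Ico (1 : ℝ) (stripYT T), ∀ N (σ : ℤ) (a b : Fin (2 * T)), SUM T N σ y a b ≤ K := by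
  classical
  have h1T := one_lt_stripYT hT
  have h1mem : (1 : ℝ) ∈ Set.Ico (1 : ℝ) (stripYT T) := ⟨le_rfl, h1T⟩
  -- irreducibility witnesses at `y = 1` (from `I_2(1) ≤ I(1)`)
  have hwit : ∀ ab : Fin (2 * T) × Fin (2 * T), ∃ j : ℕ, 0 < (Iinf T 1 ^ j) ab.1 ab.2 := by
    intro ab
    obtain ⟨j, hj⟩ := reach_Imat_all hT (N := 2) le_rfl ab.1 ab.2
    exact ⟨j, hj.trans_le (nonnegMat_pow_apply_mono (fun a b => (Imat_Dmat_nonneg (N := 2) (k := 1) zero_le_one a b).1)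
      (fun a b => Imat_le_Iinf hT h1mem 2 a b) j ab.1 ab.2)⟩
  choose jw hjw using hwit
  set Kr : ℝ := ∑ ab : Fin (2 * T) × Fin (2 * T), 1 / (Iinf T 1 ^ jw ab) ab.1 ab.2 with hKr
  have hKr_ge : ∀ a b : Fin (2 * T), 1 / (Iinf T 1 ^ jw (a, b)) a b ≤ Kr := fun a b =>
    single_le_sum (f := fun ab : Fin (2 * T) × Fin (2 * T) => 1 / (Iinf T 1 ^ jw ab) ab.1 ab.2)
      (fun ab _ => (one_div_pos.2 (hjw ab)).le) (mem_univ (a, b))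
  refine ⟨Kr, fun y hy N σ a b => ?_⟩
  have hy0 : 0 ≤ y := (sub_threshold_of_mem_Ico hT hy).2.1
  have hy1 : 1 ≤ y := hy.1
  have hA := Iinf_nonneg hT hy
  obtain ⟨s, hs1, hAs, -⟩ := nonnegMat_exists_subInvariant_vector hA (summable_pow_Iinf' hT hy)
  have hs0 : 0 ≤ s := fun a => zero_le_one.trans (hs1 a)
  have hspos : ∀ a, 0 < s a := fun a => zero_lt_one.trans_le (hs1 a)
  -- ratio bound: `s b ≤ Kr · s a`
  have hratio : ∀ a b, s b ≤ Kr * s a := by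
    intro a b
    have hmono : (Iinf T 1 ^ jw (a, b)) a b ≤ (Iinf T y ^ jw (a, b)) a b :=
      nonnegMat_pow_apply_mono (Iinf_nonneg hT h1mem)
        (fun a b => ciSup_le fun N => (Imat_mono_y zero_le_one hy1 a b).trans (Imat_le_Iinf hT hy N a b)) _ a b
    have h1 : (Iinf T y ^ jw (a, b)) a b * s b ≤ s a :=
      (nonnegMat_apply_mul_le_mulVec (nonnegMat_pow_apply_nonneg hA _) hs0 a b).trans (pow_mulVec_le_of_subInvariant hA hAs _ a)
    have hw := hjw (a, b)
    have h2 : (Iinf T 1 ^ jw (a, b)) a b * s b ≤ s a := (mul_le_mul_of_nonneg_right hmono (hs0 b)).trans h1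
    calc s b = (1 / (Iinf T 1 ^ jw (a, b)) a b) * ((Iinf T 1 ^ jw (a, b)) a b * s b) := by field_simp
      _ ≤ (1 / (Iinf T 1 ^ jw (a, b)) a b) * s a := mul_le_mul_of_nonneg_left h2 (one_div_pos.2 hw).le
      _ ≤ Kr * s a := mul_le_mul_of_nonneg_right (hKr_ge a b) (hs0 a)
  -- `U_σ(a,b) s_b ≤ (U_σ s)_a ≤ s_a ≤ Kr s_b`
  have hUs := SUM_mulVec_le_of_subInvariant (N := N) hT hy hs0 hAs σ a
  have h1 : SUM T N σ y a b * s b ≤ (SUM T N σ y *ᵥ s) a :=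
    nonnegMat_apply_mul_le_mulVec (fun a b => (SMM_SUM_nonneg hy0 σ a b).2) hs0 a b
  have h2 : SUM T N σ y a b * s b ≤ Kr * s b := (h1.trans hUs).trans (hratio b a)
  exact le_of_mul_le_mul_right h2 (hspos b)

/-- ★★★ **The horizontal bridges of exact span `σ` at the threshold are uniformly bounded**: there is `K = K(T)` with
`SUs T N σ a b (y_T) = Σ_{h : a → b standard horizontal bridge, ≤ N+1 vertices, span σ} x_c^{|h|−1} y_T^{#top(h.tail)} ≤ K` for all `N, σ, a, b`.
(Continuity of the finite sum at `y_T` from the left.)  The span analogue of the pointwise threshold law for contacts.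
[cite: DuminilCopinHammond2013, §2.2; Seneta1973, §6.2 Theorem 6.3; BeatonBousquetMelouDeGierDuminilCopinGuttmann2014, Corollary 8 (y_T); lane: NEW] -/
theorem exists_SUs_stripYT_le (hT : 1 ≤ T) :
    ∃ K : ℝ, ∀ N (σ : ℤ) (a b : Fin (2 * T)), SUs T N σ (a : ℕ) (b : ℕ) (stripYT T) ≤ K := by
  obtain ⟨K, hK⟩ := exists_SUM_le hT
  have h1T := one_lt_stripYT hT
  refine ⟨K, fun N σ a b => ?_⟩
  have hcont : ContinuousAt (fun y : ℝ => SUs T N σ (a : ℕ) (b : ℕ) y) (stripYT T) := by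
    unfold SUs wD
    exact (continuous_finsetSum _ fun l _ => continuous_const.mul (continuous_pow _)).continuousAt
  have hlim : Tendsto (fun y : ℝ => SUs T N σ (a : ℕ) (b : ℕ) y) (𝓝[<] stripYT T) (𝓝 (SUs T N σ (a : ℕ) (b : ℕ) (stripYT T))) :=
    tendsto_nhdsWithin_of_tendsto_nhds hcont.tendsto
  refine le_of_tendsto hlim ?_
  have hmem : Set.Ico (1 : ℝ) (stripYT T) ∈ 𝓝[<] stripYT T := Ico_mem_nhdsLT h1T
  filter_upwards [hmem] with y hy
  exact hK y hy N σ a b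

end Analytic

/-! ### §4 ★★★ The span-pointwise law for the horizontal-bridge series at the threshold -/

section Headline

variable {T : ℕ}

/-- `x_c^{|h|} y^{#top(h)} ≤ x_c · max(1,y) · wD(h)` for a nonempty list (the start vertex carries at most one contact).
[cite: BeatonBousquetMelouDeGierDuminilCopinGuttmann2014, §3.2 (weights); lane plumbing] (`private` — statement-twin of `HV.pow_mul_pow_topCnt_le_wD'` in `HexSAWStripBridgeLengthPointwise.lean`, which this file does not import.) -/
private theorem pow_mul_pow_topCnt_le_wD {y : ℝ} (hy : 0 ≤ y) {l : List HV} (hl : l ≠ []) :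
    hexCriticalFugacity ^ l.length * y ^ topCnt T l ≤ hexCriticalFugacity * max 1 y * wD T y l := by
  have hx := hexCriticalFugacity_pos_lt_one.1
  obtain ⟨v, t, rfl⟩ := List.exists_cons_of_ne_nil hl
  rw [wD, List.length_cons, Nat.add_sub_cancel, List.tail_cons, topCnt_cons, pow_succ, pow_add]
  have h1 : y ^ (if lev v = 2 * (T : ℤ) - 1 then 1 else 0) ≤ max 1 y := by
    split_ifs
    · rw [pow_one]; exact le_max_right _ _
    · rw [pow_zero]; exact le_max_left _ _
  have h2 : 0 ≤ hexCriticalFugacity ^ t.length * y ^ topCnt T t := mul_nonneg (pow_nonneg hx.le _) (pow_nonneg hy _)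
  calc hexCriticalFugacity ^ t.length * hexCriticalFugacity * (y ^ (if lev v = 2 * (T : ℤ) - 1 then 1 else 0) * y ^ topCnt T t)
      = (y ^ (if lev v = 2 * (T : ℤ) - 1 then 1 else 0)) * (hexCriticalFugacity * (hexCriticalFugacity ^ t.length * y ^ topCnt T t)) := by
        ring
    _ ≤ max 1 y * (hexCriticalFugacity * (hexCriticalFugacity ^ t.length * y ^ topCnt T t)) :=
        mul_le_mul_of_nonneg_right h1 (mul_nonneg hx.le h2)
    _ = hexCriticalFugacity * max 1 y * (hexCriticalFugacity ^ t.length * y ^ topCnt T t) := by ring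

/-- ★★★ **SPAN-POINTWISE LAW**: there is `K = K(T)` such that for every truncation `N` and every span `σ`, the standard horizontal
bridges of `S_T` with at least two vertices and horizontal span exactly `σ` have total weight
`Σ x_c^{|h|} y_T^{#top(h)} ≤ K` at the threshold `y_T` — uniformly in `σ` (and `N`).  The span analogue of the pointwise threshold law
for the contact count; the renewal-theoretic content is `U_σ(y) s(y) ≤ s(y)` for a sub-invariant vector below `y_T`.
[cite: DuminilCopinHammond2013, §2.2 (bridges, renewal structure); Seneta1973, §6.2 Theorem 6.3; BeatonBousquetMelouDeGierDuminilCopinGuttmann2014, Corollary 8 (y_T); lane «pcv-sawmu»: NEW] -/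
theorem exists_hBridgesN_span_stripYT_le (hT : 1 ≤ T) :
    ∃ K : ℝ, ∀ N (σ : ℤ), ∑ l ∈ (hBridgesN T N).filter (fun l => 2 ≤ l.length ∧ hsp l = σ),
      hexCriticalFugacity ^ l.length * stripYT T ^ topCnt T l ≤ K := by
  classical
  obtain ⟨K, hK⟩ := exists_SUs_stripYT_le hT
  have hy := (stripYT_pos hT).le
  have hx := hexCriticalFugacity_pos_lt_one.1
  have hK0 : 0 ≤ K := le_trans (SUs_SMs_nonneg (T := T) (N := 0) (σ := 0) hy 0 0).1 (hK 0 0 ⟨0, by omega⟩ ⟨0, by omega⟩)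
  set F : ℝ := (Fintype.card (Fin (2 * T) × Fin (2 * T)) : ℝ) with hF
  refine ⟨hexCriticalFugacity * max 1 (stripYT T) * (F * K), fun N σ => ?_⟩
  set S := (hBridgesN T N).filter (fun l => 2 ≤ l.length ∧ hsp l = σ) with hS
  -- S ⊆ ⋃_{(a,b)} SUset σ a b, a disjoint union
  have hsub : S ⊆ (Finset.univ : Finset (Fin (2 * T) × Fin (2 * T))).biUnion fun ab => SUset T N σ (ab.1 : ℕ) (ab.2 : ℕ) := by
    intro l hl
    rw [hS, mem_filter] at hl
    obtain ⟨hl, h2, hσ⟩ := hl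
    have hl' := hl
    rw [mem_hBridgesN_iff] at hl'
    obtain ⟨-, -, -, -, hin, -⟩ := hl'
    have hne : l ≠ [] := by rintro rfl; simp at h2
    obtain ⟨ha0, ha1, hb0, hb1⟩ := hdLev_ltLev_bounds (T := T) hin hne
    let a : Fin (2 * T) := ⟨(hdLev l).toNat, by omega⟩
    let b : Fin (2 * T) := ⟨(ltLev l).toNat, by omega⟩
    rw [mem_biUnion]
    refine ⟨(a, b), mem_univ _, ?_⟩
    rw [SUset, mem_filter, HBab, mem_filter]
    exact ⟨⟨hl, h2, by simp [a]; omega, by simp [b]; omega⟩, hσ⟩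
  have hdisj : Set.PairwiseDisjoint ((Finset.univ : Finset (Fin (2 * T) × Fin (2 * T))) : Set (Fin (2 * T) × Fin (2 * T)))
      fun ab : Fin (2 * T) × Fin (2 * T) => SUset T N σ (ab.1 : ℕ) (ab.2 : ℕ) := by
    intro ab _ ab' _ hne
    rw [Function.onFun, disjoint_left]
    intro l h1 h2
    rw [SUset, mem_filter, HBab, mem_filter] at h1 h2
    apply hne
    have e1 : (ab.1 : ℤ) = ab'.1 := h1.1.2.2.1.symm.trans h2.1.2.2.1
    have e2 : (ab.2 : ℤ) = ab'.2 := h1.1.2.2.2.symm.trans h2.1.2.2.2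
    exact Prod.ext (Fin.ext (by exact_mod_cast e1)) (Fin.ext (by exact_mod_cast e2))
  calc ∑ l ∈ S, hexCriticalFugacity ^ l.length * stripYT T ^ topCnt T l
      ≤ ∑ l ∈ (Finset.univ : Finset (Fin (2 * T) × Fin (2 * T))).biUnion (fun ab => SUset T N σ (ab.1 : ℕ) (ab.2 : ℕ)),
          hexCriticalFugacity ^ l.length * stripYT T ^ topCnt T l :=
        sum_le_sum_of_subset_of_nonneg hsub fun l _ _ => mul_nonneg (pow_nonneg hx.le _) (pow_nonneg hy _)
    _ = ∑ ab : Fin (2 * T) × Fin (2 * T), ∑ l ∈ SUset T N σ (ab.1 : ℕ) (ab.2 : ℕ),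
          hexCriticalFugacity ^ l.length * stripYT T ^ topCnt T l := sum_biUnion hdisj
    _ ≤ ∑ ab : Fin (2 * T) × Fin (2 * T), hexCriticalFugacity * max 1 (stripYT T) * K := by
        refine sum_le_sum fun ab _ => ?_
        calc ∑ l ∈ SUset T N σ (ab.1 : ℕ) (ab.2 : ℕ), hexCriticalFugacity ^ l.length * stripYT T ^ topCnt T l
            ≤ ∑ l ∈ SUset T N σ (ab.1 : ℕ) (ab.2 : ℕ), hexCriticalFugacity * max 1 (stripYT T) * wD T (stripYT T) l := by
              refine sum_le_sum fun l hl => pow_mul_pow_topCnt_le_wD hy ?_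
              rw [SUset, mem_filter, HBab, mem_filter] at hl
              rintro rfl; have := hl.1.2.1; simp at this
          _ = hexCriticalFugacity * max 1 (stripYT T) * SUs T N σ (ab.1 : ℕ) (ab.2 : ℕ) (stripYT T) := by rw [SUs, mul_sum]
          _ ≤ hexCriticalFugacity * max 1 (stripYT T) * K :=
              mul_le_mul_of_nonneg_left (hK N σ ab.1 ab.2) (by positivity)
    _ = hexCriticalFugacity * max 1 (stripYT T) * (F * K) := by rw [sum_const, nsmul_eq_mul, hF, Finset.card_univ]; ring

end Headline

end Literature.Probability.RandomPlanarGeometry.SAW.HV
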